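import Literature.Analysis.FunctionSpaces.LittlewoodPaleyHeatProofs
import HarnessLib

/-!
# Fourier multipliers on the dyadic blocks: BCD Lemma 2.2 and Bernstein's inequalities with
derivatives

Sibling proof file of `Literature/Analysis/FunctionSpaces/LittlewoodPaley.lean` (blocks
`Literature.Analysis.FunctionSpaces.lpBlock`,
`L^p` norms of distributions `Literature.Analysis.FunctionSpaces.eLpNormDistrib`, Besov norms `Literature.Analysis.FunctionSpaces.eHomBesovNorm`), continuing
`LittlewoodPaleyBernsteinProofs.lean` (Bernstein's inequality `‖Δ̇_j u‖_{L^r} ≲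
2^{jd(1/p-1/r)}‖Δ̇_j u‖_{L^p}`)
and `LittlewoodPaleyHeatProofs.lean` (the heat flow on the blocks), whose toolkit (Leibniz bound
localised to the support, `‖𝓕⁻¹ g‖_{L¹} ≲` Schwartz seminorms, the reproducing symbol `ψ` of `Δ̇₀`)
is reused. It **proves** the general multiplier lemma of the Littlewood–Paley theory and its first
consequences:

* `Literature.Analysis.FunctionSpaces.exists_eLpNormDistrib_fourierMultiplierCLM_lpBlock_zero_le` /
  `Literature.Analysis.FunctionSpaces.exists_eLpNormDistrib_fourierMultiplierCLM_lpBlock_le`: for `1 ≤ p ≤ ∞` there are an order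
`n`
  and a constant `C` such that for **every** multiplier `g` of temperate growth,
  `‖g(D) Δ̇_j u‖_{L^p} ≤ C B ‖Δ̇_j u‖_{L^p}` whenever the derivatives of order `≤ n` of the rescaled
  symbol `g(2^j ·)` are bounded by `B` on the annulus `1/4 ≤ ‖ξ‖ ≤ 4` (a bound *linear* in `B`,
so that
  parameter-dependent families — heat, resolvents, derivatives — are treated uniformly);
* **BCD Lemma 2.2** (`Literature.Analysis.FunctionSpaces.exists_eLpNormDistrib_truncSymbol_lpBlock_le`): if `σ ∈ C^∞(E ∖ {0})`
  satisfies `‖D^N σ(ξ)‖ ≤ C_N ‖ξ‖^{m-N}` (`ξ ≠ 0`), then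
  `‖σ_j(D) Δ̇_j u‖_{L^p} ≤ C 2^{jm} ‖Δ̇_j u‖_{L^p}`, where `σ_j = σ ψ(2^{-j} ·)`
(`Literature.Analysis.FunctionSpaces.truncSymbol`) is the
  block truncation making `σ(D) Δ̇_j` an honest Fourier multiplier for symbols singular at the
origin
  (`|ξ|^m`, Leray projector, Riesz transforms); for temperate `σ` the truncation is invisible
  (`Literature.Analysis.FunctionSpaces.fourierMultiplierCLM_truncSymbol_lpBlock`);
* **Bernstein's inequalities with derivatives** (BCD Lemma 2.1, `k = 1, 2`, direct part; Danchin
  2018, Prop. 2.1 (i)): `‖∂_m Δ̇_j u‖_{L^p} ≤ C 2^j ‖m‖ ‖Δ̇_j u‖_{L^p}`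
  (`Literature.Analysis.FunctionSpaces.exists_eLpNormDistrib_lineDeriv_lpBlock_le`, Mathlib's `∂_{m}` = `LineDeriv` on `𝓢'`) and
  `‖Δ Δ̇_j u‖_{L^p} ≤ C 2^{2j} ‖Δ̇_j u‖_{L^p}` (`Literature.Analysis.FunctionSpaces.exists_eLpNormDistrib_laplacian_lpBlock_le`,
Mathlib's
  distributional Laplacian), the commutation of `Δ̇_j`, `Ṡ_j` with `∂_m`, `Δ`, and at the level of
  Besov norms `‖∂_m u‖_{Ḃ^{s-1}_{p,q}} ≤ C ‖m‖ ‖u‖_{Ḃ^s_{p,q}}`, `‖Δ u‖_{Ḃ^{s-2}_{p,q}} ≤ C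
‖u‖_{Ḃ^s_{p,q}}`
  (`Literature.Analysis.FunctionSpaces.exists_eHomBesovNorm_lineDeriv_le`, `Literature.Analysis.FunctionSpaces.exists_eHomBesovNorm_laplacian_le`) with the
classes
  `Literature.Analysis.FunctionSpaces.MemHomBesov.lineDeriv`, `Literature.Analysis.FunctionSpaces.MemHomBesov.laplacian` (Danchin 2018, §2.2: "the gradient
operator
  maps `Ḃ^s_{p,r}` in `Ḃ^{s-1}_{p,r}`").

Also: `Literature.Analysis.FunctionSpaces.eLpNormDistrib_const_smul` (`‖c • u‖_{L^p} = ‖c‖ ‖u‖_{L^p}` on `𝓢'`),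
`Literature.Analysis.FunctionSpaces.contDiff_mul_of_tsupport_subset` (smoothness of `σ ψ` for `σ` smooth near `supp ψ`).

## The proof (BCD, proofs of Lemmas 2.1–2.2)

At frequency `1`: `g(D) Δ̇₀ u = (gψ)(D) Δ̇₀ u = 𝓕⁻¹(gψ) ⋆ Δ̇₀ u` (`Δ̇₀ = ψ(D) Δ̇₀`,
`Literature.Analysis.FunctionSpaces.lpBlock_zero_eq_fourierMultiplierCLM_bernsteinSymbol`; kernel representation
`Literature.Analysis.FunctionSpaces.fourierMultiplierCLM_coe_apply_eq_integral_convolution`), Young's inequality, and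
`‖𝓕⁻¹(gψ)‖_{L¹} ≤ C sup_{i ∈ s} p_i(gψ) ≤ C' B` by the localised Leibniz bound
(`Literature.Analysis.FunctionSpaces.seminorm_smulLeftCLM_le_of_bound_on`) — the finite set `s` of Schwartz seminorms controlling
`𝓢 → L¹ ∘ 𝓕⁻¹` (`Literature.Analysis.FunctionSpaces.exists_eLpNorm_fourierInv_le`) fixes the order `n`. All frequencies:
`g(D)(v(2^j ·)) = (g(2^j ·)(D) v)(2^j ·)` (`Literature.Analysis.FunctionSpaces.fourierMultiplierCLM_distribDilate`) and
`‖v(2^j ·)‖_{L^p} = 2^{-jd/p} ‖v‖_{L^p}` on both sides. For BCD Lemma 2.2 the rescaled truncated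
symbol is
`σ(2^j x) ψ(x)`, whose derivatives on the annulus are `≤ K 2^{jm}` uniformly in `j`
(`Literature.Analysis.FunctionSpaces.exists_norm_iteratedFDeriv_truncSymbol_rescaled_le`: Leibniz and the chain rule on the open
set
`E ∖ {0}`, `‖x‖^{m-i} ≤ 4^{|m|+n}` on the annulus).

## References

* H. Bahouri, J.-Y. Chemin, R. Danchin, *Fourier Analysis and Nonlinear Partial Differential
  Equations*, Grundlehren 343, Springer (2011), Lemma 2.1 (Bernstein), Lemma 2.2 (homogeneous
Fourier
  multipliers on functions with Fourier support in an annulus `λ𝒞`: `‖σ(D)u‖_{L^p} ≤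
Cλ^m‖u‖_{L^p}`).
  [cite: BahouriCheminDanchin2011, Lemma 2.2]
* R. Danchin, *Fourier analysis methods for the compressible Navier–Stokes equations* (2018;
  arXiv:1507.02637), Prop. 2.1 (Bernstein inequalities, p. 4) and §2.2 (p. 5: "the gradient operator
  maps `Ḃ^s_{p,r}` in `Ḃ^{s-1}_{p,r}`"). [cite: Danchin2018FourierCNS, Prop. 2.1]
* I. Gallagher, G. S. Koch, F. Planchon, Comm. Math. Phys. 343 (2016), Appendix B ("by Bernstein's
  inequalities and the zero-order nature of `ℙ`"). [cite: GKP2016, App. B]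
-/

noncomputable section

open MeasureTheory TemperedDistribution SchwartzMap Filter Topology Function
open scoped SchwartzMap ENNReal NNReal FourierTransform Real ContDiff Convolution

namespace Literature.Analysis.FunctionSpaces

section SmoothTrunc

variable {E : Type*} [NormedAddCommGroup E] [NormedSpace ℝ E]

/-- A function smooth on an open set `U`, multiplied by a smooth function whose support lies in
`U`, is smooth everywhere (off `tsupport ψ` the product vanishes identically near each point).
[folklore] -/
theorem contDiff_mul_of_tsupport_subset {U : Set E} (hU : IsOpen U) {σ ψ : E → ℂ}
    (hσ : ContDiffOn ℝ ∞ σ U) (hψ : ContDiff ℝ ∞ ψ) (hsupp : tsupport ψ ⊆ U) :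
    ContDiff ℝ ∞ (σ * ψ) := by
  refine contDiff_iff_contDiffAt.2 fun x => ?_
  by_cases hx : x ∈ U
  · exact (hσ.contDiffAt (hU.mem_nhds hx)).mul hψ.contDiffAt
  · have hx' : x ∉ tsupport ψ := fun h => hx (hsupp h)
    have h0 : ψ =ᶠ[𝓝 x] 0 := notMem_tsupport_iff_eventuallyEq.1 hx'
    have h1 : σ * ψ =ᶠ[𝓝 x] fun _ => 0 := by
      filter_upwards [h0] with y hy
      simp [hy]
    exact (contDiffAt_const (c := (0 : ℂ))).congr_of_eventuallyEq h1

end SmoothTrunc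

/-! ## Fourier multipliers on the block `Δ̇₀`, uniformly in the symbol -/

section BlockMultiplier

variable {E : Type*} [NormedAddCommGroup E] [InnerProductSpace ℝ E] [FiniteDimensional ℝ E]
  [MeasurableSpace E] [BorelSpace E] {F : Type*} [NormedAddCommGroup F] [NormedSpace ℂ F]
  [CompleteSpace F]

/-- The closed annulus `𝒜 = {1/4 ≤ ‖ξ‖ ≤ 4}` carrying `supp ψ` (and `supp φ₀ ⊆ {1/2 ≤ ‖ξ‖ ≤ 2}`).
[folklore] -/
def blockAnnulus (E : Type*) [NormedAddCommGroup E] : Set E := {ξ : E | 4⁻¹ ≤ ‖ξ‖ ∧ ‖ξ‖ ≤ 4}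

omit [InnerProductSpace ℝ E] [FiniteDimensional ℝ E] [MeasurableSpace E] [BorelSpace E] in
/-- Membership in the annulus `𝒜`. [folklore] -/
theorem mem_blockAnnulus {ξ : E} : ξ ∈ blockAnnulus E ↔ 4⁻¹ ≤ ‖ξ‖ ∧ ‖ξ‖ ≤ 4 := Iff.rfl

/-- **Fourier multipliers on `Δ̇₀`, with a bound linear in the symbol** (BCD, proof of Lemma 2.2
at `λ = 1`): for `1 ≤ p ≤ ∞` there are an order `n` and a constant `C` (depending only on `p`,
`d = dim E` and the fixed cut-off) such that for every multiplier `g` of temperate growth whose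
derivatives of order `≤ n` are bounded by `B` on the annulus `1/4 ≤ ‖ξ‖ ≤ 4`, and every
`u ∈ 𝓢'(E, F)`, `‖g(D) Δ̇₀ u‖_{L^p} ≤ C B ‖Δ̇₀ u‖_{L^p}`.
[cite: BahouriCheminDanchin2011, Lemma 2.2] -/
theorem exists_eLpNormDistrib_fourierMultiplierCLM_lpBlock_zero_le (p : ℝ≥0∞) [hp : Fact (1 ≤ p)] :
    ∃ (n : ℕ) (C : ℝ≥0), ∀ (g : E → ℂ), g.HasTemperateGrowth → ∀ B : ℝ, 0 ≤ B →
      (∀ N ≤ n, ∀ x ∈ blockAnnulus E, ‖iteratedFDeriv ℝ N g x‖ ≤ B) →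
      ∀ u : 𝓢'(E, F), eLpNormDistrib p (fourierMultiplierCLM F g (lpBlock 0 u)) ≤
        C * ENNReal.ofReal B * eLpNormDistrib p (lpBlock 0 u) := by
  obtain ⟨s, C₀, h₀⟩ := exists_eLpNorm_fourierInv_le (E := E)
  -- the order: the largest derivative index occurring in `s`; the constant: `C₀ ∑ 2^{i₂} sup p(ψ)`
  set n : ℕ := s.sup Prod.snd with hn
  set A : ℝ := ∑ i ∈ s, 2 ^ i.2 * (Finset.Iic i).sup (schwartzSeminormFamily ℂ E ℂ) (bernsteinSchwartz E)
    with hA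
  have hA0 : 0 ≤ A := Finset.sum_nonneg fun i _ => by positivity
  refine ⟨n, max (C₀ * A.toNNReal) 1, fun g hg B hB hgB u => ?_⟩
  have hS : tsupport ((bernsteinSchwartz E : 𝓢(E, ℂ)) : E → ℂ) ⊆ blockAnnulus E := by
    rw [coe_bernsteinSchwartz]
    exact tsupport_bernsteinSymbol_subset
  -- the Schwartz symbol `g ψ` and its seminorms
  set Ψ : 𝓢(E, ℂ) := SchwartzMap.smulLeftCLM ℂ g (bernsteinSchwartz E) with hΨ
  have hΨcoe : (bernsteinSymbol : E → ℂ) * g = ⇑Ψ := by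
    rw [hΨ, SchwartzMap.smulLeftCLM_apply hg, coe_bernsteinSchwartz]
    funext ξ
    simp only [Pi.mul_apply, smul_eq_mul, mul_comm]
  have hsemi : ∀ i ∈ s, schwartzSeminormFamily ℂ E ℂ i Ψ ≤
      2 ^ i.2 * (Finset.Iic i).sup (schwartzSeminormFamily ℂ E ℂ) (bernsteinSchwartz E) * B := by
    intro i hi
    have hin : i.2 ≤ n := Finset.le_sup (f := Prod.snd) hi
    have h := seminorm_smulLeftCLM_le_of_bound_on hg hS (n := i.2) hB
      (fun N hN x hx => hgB N (hN.trans hin) x hx) i.1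
    calc schwartzSeminormFamily ℂ E ℂ i Ψ = SchwartzMap.seminorm ℂ i.1 i.2 Ψ := rfl
      _ ≤ 2 ^ i.2 * B * (Finset.Iic (i.1, i.2)).sup (schwartzSeminormFamily ℂ E ℂ) (bernsteinSchwartz E) := h
      _ = 2 ^ i.2 * (Finset.Iic i).sup (schwartzSeminormFamily ℂ E ℂ) (bernsteinSchwartz E) * B := by
          rw [Prod.mk.eta]; ring
  have hsup : s.sup (schwartzSeminormFamily ℂ E ℂ) Ψ ≤ A * B := by
    refine Seminorm.finset_sup_apply_le (by positivity) fun i hi => (hsemi i hi).trans ?_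
    rw [hA, Finset.sum_mul]
    exact Finset.single_le_sum (f := fun i => 2 ^ i.2 *
      (Finset.Iic i).sup (schwartzSeminormFamily ℂ E ℂ) (bernsteinSchwartz E) * B)
      (fun j _ => by positivity) hi
  have hK1 : eLpNorm (⇑(𝓕⁻ Ψ : 𝓢(E, ℂ))) 1 volume ≤ (C₀ * A.toNNReal : ℝ≥0) * ENNReal.ofReal B := by
    calc eLpNorm (⇑(𝓕⁻ Ψ : 𝓢(E, ℂ))) 1 volume ≤ C₀ * ENNReal.ofReal (s.sup (schwartzSeminormFamily ℂ E ℂ) Ψ) :=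
          h₀ Ψ
      _ ≤ C₀ * ENNReal.ofReal (A * B) := by gcongr
      _ = (C₀ * A.toNNReal : ℝ≥0) * ENNReal.ofReal B := by
          rw [ENNReal.ofReal_mul hA0, ENNReal.coe_mul, mul_assoc]
          rfl
  -- `g(D) Δ̇₀ u = (ψ g)(D) Δ̇₀ u = Ψ(D) Δ̇₀ u`
  have hop : fourierMultiplierCLM F g (lpBlock 0 u) = fourierMultiplierCLM F (⇑Ψ) (lpBlock 0 u) := by
    calc fourierMultiplierCLM F g (lpBlock 0 u)
        = fourierMultiplierCLM F g (fourierMultiplierCLM F (bernsteinSymbol : E → ℂ) (lpBlock 0 u)) := by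
          rw [← lpBlock_zero_eq_fourierMultiplierCLM_bernsteinSymbol]
      _ = fourierMultiplierCLM F ((bernsteinSymbol : E → ℂ) * g) (lpBlock 0 u) :=
          TemperedDistribution.fourierMultiplierCLM_fourierMultiplierCLM_apply
            hasTemperateGrowth_bernsteinSymbol hg _
      _ = fourierMultiplierCLM F (⇑Ψ) (lpBlock 0 u) := by rw [hΨcoe]
  rw [hop]
  by_cases h : ∃ f : Lp F p (volume : Measure E), (f : 𝓢'(E, F)) = lpBlock 0 u
  · obtain ⟨f, hf⟩ := h
    set K : 𝓢(E, ℂ) := 𝓕⁻ Ψ with hKdef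
    have hK : AEStronglyMeasurable (⇑K) (volume : Measure E) := K.continuous.aestronglyMeasurable
    have hfm : AEStronglyMeasurable (f : E → F) volume := Lp.aestronglyMeasurable f
    have hY : eLpNorm ((⇑K) ⋆[ContinuousLinearMap.lsmul ℂ ℂ, volume] (f : E → F)) p volume ≤
        eLpNorm (⇑K) 1 volume * eLpNorm (f : E → F) p volume := by
      rw [eLpNorm_one_eq_lintegral_enorm]
      exact eLpNorm_convolution_smul_le hK hfm hp.out
    have hgm : MemLp ((⇑K) ⋆[ContinuousLinearMap.lsmul ℂ ℂ, volume] (f : E → F)) p volume :=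
      ⟨aestronglyMeasurable_convolution_smul hK hfm, hY.trans_lt
        (ENNReal.mul_lt_top (K.eLpNorm_lt_top 1 volume) (Lp.memLp f).eLpNorm_lt_top)⟩
    have hrep : ((hgm.toLp _ : Lp F p (volume : Measure E)) : 𝓢'(E, F)) =
        fourierMultiplierCLM F (⇑Ψ) (lpBlock 0 u) := by
      rw [← hf]
      ext φ
      rw [Lp.toTemperedDistribution_apply, fourierMultiplierCLM_coe_apply_eq_integral_convolution]
      refine integral_congr_ae ?_
      filter_upwards [hgm.coeFn_toLp] with y hy
      rw [hy]
    calc eLpNormDistrib p (fourierMultiplierCLM F (⇑Ψ) (lpBlock 0 u))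
        ≤ ‖(hgm.toLp _ : Lp F p (volume : Measure E))‖ₑ := by
          rw [← hrep]; exact eLpNormDistrib_coe_le _
      _ = eLpNorm ((⇑K) ⋆[ContinuousLinearMap.lsmul ℂ ℂ, volume] (f : E → F)) p volume :=
          Lp.enorm_toLp hgm
      _ ≤ eLpNorm (⇑K) 1 volume * eLpNorm (f : E → F) p volume := hY
      _ ≤ ((C₀ * A.toNNReal : ℝ≥0) * ENNReal.ofReal B) * eLpNorm (f : E → F) p volume := by
          gcongr
      _ ≤ ((max (C₀ * A.toNNReal) 1 : ℝ≥0) * ENNReal.ofReal B) * eLpNorm (f : E → F) p volume := by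
          gcongr
          exact le_max_left _ _
      _ = (max (C₀ * A.toNNReal) 1 : ℝ≥0) * ENNReal.ofReal B * eLpNormDistrib p (lpBlock 0 u) := by
          rw [← hf, eLpNormDistrib_coe, Lp.enorm_def]
  · push Not at h
    rcases hB.eq_or_lt with hB0 | hBpos
    · -- `B = 0`: then `g ψ = 0`, so the operator vanishes
      have hΨ0 : Ψ = 0 := by
        ext ξ
        rw [← hΨcoe]
        change bernsteinSymbol ξ * g ξ = 0
        rw [mul_eq_zero]
        by_cases hξ : ξ ∈ blockAnnulus E
        · right
          have := hgB 0 (Nat.zero_le _) ξ hξ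
          rw [← hB0, norm_iteratedFDeriv_zero] at this
          exact norm_le_zero_iff.1 this
        · left
          have hξ' : ξ ∉ tsupport (bernsteinSymbol : E → ℂ) := fun h' => hξ (tsupport_bernsteinSymbol_subset h')
          exact image_eq_zero_of_notMem_tsupport hξ'
      have hop0 : fourierMultiplierCLM F (⇑Ψ) (lpBlock 0 u) = 0 := by
        rw [hΨ0]
        ext φ
        rw [fourierMultiplierCLM_apply_apply]
        have h00 : SchwartzMap.smulLeftCLM ℂ (⇑(0 : 𝓢(E, ℂ))) (𝓕⁻ φ) = 0 := by
          ext x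
          rw [SchwartzMap.smulLeftCLM_apply (0 : 𝓢(E, ℂ)).hasTemperateGrowth]
          simp
        rw [h00, FourierTransform.fourier_zero, map_zero]
        rfl
      rw [hop0, eLpNormDistrib_zero]
      exact bot_le
    · rw [eLpNormDistrib_of_forall_ne h,
        ENNReal.mul_top (mul_ne_zero (by simp) (ENNReal.ofReal_pos.2 hBpos).ne')]
      exact le_top

end BlockMultiplier

/-! ## All frequencies by dyadic scaling -/

section BlockMultiplierScaled

variable {E : Type*} [NormedAddCommGroup E] [InnerProductSpace ℝ E] [FiniteDimensional ℝ E]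
  [MeasurableSpace E] [BorelSpace E] {F : Type*} [NormedAddCommGroup F] [NormedSpace ℂ F]
  [CompleteSpace F]

/-- **Fourier multipliers on `Δ̇_j`, with a bound linear in the rescaled symbol** (BCD, proof of
Lemma 2.2: "a suitable change of variable reduces the proof to `λ = 1`"): with `n`, `C` as in
`exists_eLpNormDistrib_fourierMultiplierCLM_lpBlock_zero_le`, for every multiplier `g` of temperate
growth, every `j ∈ ℤ` and every `B ≥ 0` bounding the derivatives of order `≤ n` of the rescaled
symbol `g(2^j ·)` on the annulus `1/4 ≤ ‖ξ‖ ≤ 4`: `‖g(D) Δ̇_j u‖_{L^p} ≤ C B ‖Δ̇_j u‖_{L^p}` for all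
`u ∈ 𝓢'(E, F)` (`g(D)(v(2^j ·)) = (g(2^j ·)(D) v)(2^j ·)` and `‖v(2^j ·)‖_{L^p} =
2^{-jd/p}‖v‖_{L^p}` on
both sides). [cite: BahouriCheminDanchin2011, Lemma 2.2] -/
theorem exists_eLpNormDistrib_fourierMultiplierCLM_lpBlock_le (p : ℝ≥0∞) [Fact (1 ≤ p)] :
    ∃ (n : ℕ) (C : ℝ≥0), ∀ (g : E → ℂ), g.HasTemperateGrowth → ∀ (j : ℤ) (B : ℝ), 0 ≤ B →
      (∀ N ≤ n, ∀ x ∈ blockAnnulus E,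
        ‖iteratedFDeriv ℝ N (fun ξ : E => g (((2 : ℝ) ^ j) • ξ)) x‖ ≤ B) →
      ∀ u : 𝓢'(E, F), eLpNormDistrib p (fourierMultiplierCLM F g (lpBlock j u)) ≤
        C * ENNReal.ofReal B * eLpNormDistrib p (lpBlock j u) := by
  obtain ⟨n, C, hC⟩ := exists_eLpNormDistrib_fourierMultiplierCLM_lpBlock_zero_le (E := E) (F := F) p
  refine ⟨n, C, fun g hg j B hB hgB u => ?_⟩
  set c : ℝˣ := Units.mk0 ((2 : ℝ) ^ j) (zpow_ne_zero j two_ne_zero) with hc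
  set w : 𝓢'(E, F) := distribDilate c⁻¹ u
  have hu : u = distribDilate c w := (distribDilate_distribDilate_inv c u).symm
  have hblock : lpBlock j u = distribDilate c (lpBlock 0 w) := by
    conv_lhs => rw [hu, hc, lpBlock_distribDilate_holds j j w, sub_self]
  have hgc : (fun ξ : E => g ((c : ℝ) • ξ)).HasTemperateGrowth :=
    hg.comp ((c : ℝ) • ContinuousLinearMap.id ℝ E).hasTemperateGrowth
  have hK : ∀ v : 𝓢'(E, F), eLpNormDistrib p (distribDilate c v) =
      (2 : ℝ≥0∞) ^ (-((j : ℝ) * Module.finrank ℝ E) / p.toReal) * eLpNormDistrib p v := by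
    intro v
    rw [eLpNormDistrib_distribDilate, hc, Units.val_mk0, dilateConst_two_zpow]
  rw [hblock, fourierMultiplierCLM_distribDilate hg, hK, hK]
  have h0 := hC (fun ξ : E => g ((c : ℝ) • ξ)) hgc B hB (by simpa only [hc, Units.val_mk0] using hgB) w
  calc (2 : ℝ≥0∞) ^ (-((j : ℝ) * Module.finrank ℝ E) / p.toReal) *
        eLpNormDistrib p (fourierMultiplierCLM F (fun ξ : E => g ((c : ℝ) • ξ)) (lpBlock 0 w))
      ≤ (2 : ℝ≥0∞) ^ (-((j : ℝ) * Module.finrank ℝ E) / p.toReal) *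
          (C * ENNReal.ofReal B * eLpNormDistrib p (lpBlock 0 w)) := by gcongr
    _ = C * ENNReal.ofReal B * ((2 : ℝ≥0∞) ^ (-((j : ℝ) * Module.finrank ℝ E) / p.toReal) *
          eLpNormDistrib p (lpBlock 0 w)) := by ring

end BlockMultiplierScaled

/-! ## Bernstein's direct inequalities with derivatives: `∂_m Δ̇_j` and `Δ Δ̇_j` -/

section DerivativeBernstein

open scoped LineDeriv Laplacian

variable {E : Type*} [NormedAddCommGroup E] [InnerProductSpace ℝ E]

/-- Derivatives of a continuous linear map `L : E → ℂ`: `‖D^N L(x)‖ ≤ max (‖L‖ ‖x‖) ‖L‖` for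
every `N`
(`= ‖L x‖`, `‖L‖`, `0` for `N = 0`, `1`, `≥ 2`). [folklore] -/
theorem norm_iteratedFDeriv_clm_apply_le (L : E →L[ℝ] ℂ) (x : E) (N : ℕ) :
    ‖iteratedFDeriv ℝ N (⇑L) x‖ ≤ max (‖L‖ * ‖x‖) ‖L‖ := by
  rcases N with _ | N
  · rw [norm_iteratedFDeriv_zero]
    exact (L.le_opNorm x).trans (le_max_left _ _)
  · have hL : fderiv ℝ (⇑L) = fun _ => L := by
      funext y
      exact L.fderiv
    rw [← norm_iteratedFDeriv_fderiv, hL]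
    rcases N with _ | N
    · rw [norm_iteratedFDeriv_zero]
      exact le_max_right _ _
    · rw [iteratedFDeriv_const_of_ne (by omega), Pi.zero_apply, norm_zero]
      positivity

/-- The rescaled symbol of `∂_m`: `ξ ↦ ⟪2^j ξ, m⟫` is the continuous linear map
`2^j · (ofReal ∘ ⟪m, ·⟫)`. [folklore] -/
theorem inner_two_zpow_smul_eq_clm (m : E) (j : ℤ) :
    (fun ξ : E => ((inner ℝ (((2 : ℝ) ^ j) • ξ) m : ℝ) : ℂ)) =
      ⇑(((2 : ℝ) ^ j) • (Complex.ofRealCLM.comp (innerSL ℝ m))) := by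
  funext ξ
  simp only [FunLike.coe_smul, Pi.smul_apply, ContinuousLinearMap.coe_comp,
    comp_apply, innerSL_apply_apply, Complex.ofRealCLM_apply, real_inner_smul_left, real_inner_comm m ξ,
    Complex.real_smul, Complex.ofReal_mul]

/-- `‖2^j · (ofReal ∘ ⟪m, ·⟫)‖ ≤ 2^j ‖m‖`. [folklore] -/
theorem norm_two_zpow_smul_inner_clm_le (m : E) (j : ℤ) :
    ‖((2 : ℝ) ^ j) • (Complex.ofRealCLM.comp (innerSL ℝ m))‖ ≤ (2 : ℝ) ^ j * ‖m‖ := by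
  rw [norm_smul, Real.norm_of_nonneg (zpow_nonneg zero_le_two _)]
  gcongr
  calc ‖Complex.ofRealCLM.comp (innerSL ℝ m)‖ ≤ ‖Complex.ofRealCLM‖ * ‖innerSL ℝ m‖ :=
        ContinuousLinearMap.opNorm_comp_le _ _
    _ ≤ 1 * ‖m‖ := by
        gcongr
        · exact Complex.ofRealLI.norm_toContinuousLinearMap_le
        · exact (innerSL_apply_norm ℝ m).le
    _ = ‖m‖ := one_mul _

variable [FiniteDimensional ℝ E] [MeasurableSpace E] [BorelSpace E]
  {F : Type*} [NormedAddCommGroup F] [NormedSpace ℂ F]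

/-- The directional derivative commutes with the dyadic blocks: `Δ̇_j ∂_m = ∂_m Δ̇_j` on `𝓢'(E, F)`
(both are Fourier multipliers, `TemperedDistribution.lineDeriv_eq_fourierMultiplierCLM`).
[folklore] -/
theorem lpBlock_lineDeriv_comm (m : E) (j : ℤ) (u : 𝓢'(E, F)) :
    lpBlock j (∂_{m} u) = ∂_{m} (lpBlock j u) := by
  have hg : (fun x : E => ((inner ℝ x m : ℝ) : ℂ)).HasTemperateGrowth := by fun_prop
  rw [TemperedDistribution.lineDeriv_eq_fourierMultiplierCLM,
    TemperedDistribution.lineDeriv_eq_fourierMultiplierCLM, map_smul, lpBlock_apply, lpBlock_apply,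
    TemperedDistribution.fourierMultiplierCLM_fourierMultiplierCLM_apply hg
      (hasTemperateGrowth_dyadicSymbol j),
    TemperedDistribution.fourierMultiplierCLM_fourierMultiplierCLM_apply
      (hasTemperateGrowth_dyadicSymbol j) hg, mul_comm (dyadicSymbol (E := E) j)]

/-- The Laplacian commutes with the dyadic blocks: `Δ̇_j Δ = Δ Δ̇_j` on `𝓢'(E, F)`
(`TemperedDistribution.laplacian_eq_fourierMultiplierCLM`). [folklore] -/
theorem lpBlock_laplacian_comm (j : ℤ) (u : 𝓢'(E, F)) :
    lpBlock j (Δ u) = Δ (lpBlock j u) := by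
  have hg : (fun x : E => ((‖x‖ ^ 2 : ℝ) : ℂ)).HasTemperateGrowth := by fun_prop
  rw [TemperedDistribution.laplacian_eq_fourierMultiplierCLM,
    TemperedDistribution.laplacian_eq_fourierMultiplierCLM, ContinuousLinearMap.map_smul_of_tower,
    lpBlock_apply, lpBlock_apply,
    TemperedDistribution.fourierMultiplierCLM_fourierMultiplierCLM_apply hg
      (hasTemperateGrowth_dyadicSymbol j),
    TemperedDistribution.fourierMultiplierCLM_fourierMultiplierCLM_apply
      (hasTemperateGrowth_dyadicSymbol j) hg, mul_comm (dyadicSymbol (E := E) j)]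

variable [CompleteSpace F]

/-- `‖c • u‖_{L^p} = ‖c‖ ‖u‖_{L^p}` for tempered distributions and `Literature.Analysis.FunctionSpaces.eLpNormDistrib`, `c ≠ 0`
(`u ∈ L^p ↔ c • u ∈ L^p`). [folklore] -/
theorem eLpNormDistrib_const_smul {p : ℝ≥0∞} [Fact (1 ≤ p)] {c : ℂ} (hc : c ≠ 0) (u : 𝓢'(E, F)) :
    eLpNormDistrib p (c • u) = ‖c‖ₑ * eLpNormDistrib p u := by
  by_cases hu : ∃ f : Lp F p (volume : Measure E), (f : 𝓢'(E, F)) = u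
  · obtain ⟨f, rfl⟩ := hu
    have h : (((c • f : Lp F p (volume : Measure E))) : 𝓢'(E, F)) = c • (f : 𝓢'(E, F)) := by
      rw [← Lp.toTemperedDistributionCLM_apply, ← Lp.toTemperedDistributionCLM_apply, map_smul]
    rw [← h, eLpNormDistrib_coe, eLpNormDistrib_coe, Lp.enorm_def, Lp.enorm_def,
      eLpNorm_congr_ae (Lp.coeFn_smul c f), eLpNorm_const_smul]
  · push Not at hu
    have hu' : ∀ g : Lp F p (volume : Measure E), (g : 𝓢'(E, F)) ≠ c • u := by
      intro g hg
      apply hu (c⁻¹ • g)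
      rw [← Lp.toTemperedDistributionCLM_apply, map_smul, Lp.toTemperedDistributionCLM_apply, hg,
        smul_smul, inv_mul_cancel₀ hc, one_smul]
    rw [eLpNormDistrib_of_forall_ne hu, eLpNormDistrib_of_forall_ne hu',
      ENNReal.mul_top (by simpa using hc)]

/-- **Bernstein's inequality with one derivative** (BCD Lemma 2.1, `k = 1`, direct part; Danchin
2018,
Prop. 2.1 (i)): for `1 ≤ p ≤ ∞` there is `C` with `‖∂_m Δ̇_j u‖_{L^p} ≤ C 2^j ‖m‖ ‖Δ̇_j u‖_{L^p}`
for all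
directions `m ∈ E`, `j ∈ ℤ`, `u ∈ 𝓢'(E, F)` (`∂_m = 2πi ⟪D, m⟫`, a multiplier whose rescaled symbol
`2^j ⟪ξ, m⟫` has all derivatives `≤ 4 · 2^j ‖m‖` on the annulus).
[cite: BahouriCheminDanchin2011, Lemma 2.1] -/
theorem exists_eLpNormDistrib_lineDeriv_lpBlock_le (p : ℝ≥0∞) [Fact (1 ≤ p)] :
    ∃ C : ℝ≥0, ∀ (m : E) (j : ℤ) (u : 𝓢'(E, F)),
      eLpNormDistrib p (∂_{m} (lpBlock j u)) ≤
        C * ENNReal.ofReal ((2 : ℝ) ^ j * ‖m‖) * eLpNormDistrib p (lpBlock j u) := by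
  obtain ⟨n, C, hC⟩ := exists_eLpNormDistrib_fourierMultiplierCLM_lpBlock_le (E := E) (F := F) p
  refine ⟨‖(2 * π * Complex.I : ℂ)‖₊ * C * 4, fun m j u => ?_⟩
  have hg : (fun x : E => ((inner ℝ x m : ℝ) : ℂ)).HasTemperateGrowth := by fun_prop
  set L : E →L[ℝ] ℂ := ((2 : ℝ) ^ j) • (Complex.ofRealCLM.comp (innerSL ℝ m)) with hL
  have hB : ∀ N ≤ n, ∀ x ∈ blockAnnulus E,
      ‖iteratedFDeriv ℝ N (fun ξ : E => ((inner ℝ (((2 : ℝ) ^ j) • ξ) m : ℝ) : ℂ)) x‖ ≤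
        4 * ((2 : ℝ) ^ j * ‖m‖) := by
    intro N _ x hx
    rw [inner_two_zpow_smul_eq_clm m j]
    have hLn := norm_two_zpow_smul_inner_clm_le m j
    have h0 : 0 ≤ (2 : ℝ) ^ j * ‖m‖ := by positivity
    refine (norm_iteratedFDeriv_clm_apply_le _ x N).trans (max_le ?_ ?_)
    · calc ‖L‖ * ‖x‖ ≤ ((2 : ℝ) ^ j * ‖m‖) * 4 := mul_le_mul hLn hx.2 (norm_nonneg _) h0
        _ = 4 * ((2 : ℝ) ^ j * ‖m‖) := by ring
    · linarith
  have hmain := hC _ hg j (4 * ((2 : ℝ) ^ j * ‖m‖)) (by positivity) hB u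
  have h2pi : (2 * π * Complex.I : ℂ) ≠ 0 := by simp [Real.pi_ne_zero]
  rw [TemperedDistribution.lineDeriv_eq_fourierMultiplierCLM, eLpNormDistrib_const_smul h2pi]
  calc ‖(2 * π * Complex.I : ℂ)‖ₑ * eLpNormDistrib p (fourierMultiplierCLM F
        (fun x : E => ((inner ℝ x m : ℝ) : ℂ)) (lpBlock j u))
      ≤ ‖(2 * π * Complex.I : ℂ)‖ₑ * (C * ENNReal.ofReal (4 * ((2 : ℝ) ^ j * ‖m‖)) *
          eLpNormDistrib p (lpBlock j u)) := by gcongr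
    _ = ((‖(2 * π * Complex.I : ℂ)‖₊ * C * 4 : ℝ≥0) : ℝ≥0∞) * ENNReal.ofReal ((2 : ℝ) ^ j * ‖m‖) *
          eLpNormDistrib p (lpBlock j u) := by
        rw [ENNReal.ofReal_mul (by norm_num), ENNReal.ofReal_ofNat, ENNReal.coe_mul, ENNReal.coe_mul,
          enorm_eq_nnnorm]
        push_cast
        ring

/-- **Bernstein's inequality for the Laplacian** (BCD Lemma 2.1, `k = 2`, direct part):
for `1 ≤ p ≤ ∞` there is `C` with `‖Δ Δ̇_j u‖_{L^p} ≤ C 2^{2j} ‖Δ̇_j u‖_{L^p}` for all `j ∈ ℤ`,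
`u ∈ 𝓢'(E, F)` (`Δ = -(2π)² |D|²`, rescaled symbol `4^j ‖ξ‖²`).
[cite: BahouriCheminDanchin2011, Lemma 2.1] -/
theorem exists_eLpNormDistrib_laplacian_lpBlock_le (p : ℝ≥0∞) [Fact (1 ≤ p)] :
    ∃ C : ℝ≥0, ∀ (j : ℤ) (u : 𝓢'(E, F)),
      eLpNormDistrib p (Δ (lpBlock j u)) ≤
        C * ENNReal.ofReal ((2 : ℝ) ^ (2 * j)) * eLpNormDistrib p (lpBlock j u) := by
  obtain ⟨n, C, hC⟩ := exists_eLpNormDistrib_fourierMultiplierCLM_lpBlock_le (E := E) (F := F) p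
  -- a bound for all derivatives of `‖·‖²` on the annulus, of every order `≤ n`
  set K : ℝ := max 16 (8 ^ n) with hK
  refine ⟨‖(-(2 * π) ^ 2 : ℂ)‖₊ * C * K.toNNReal, fun j u => ?_⟩
  have hg : (fun x : E => ((‖x‖ ^ 2 : ℝ) : ℂ)).HasTemperateGrowth := by fun_prop
  have hK0 : 0 ≤ K := le_max_of_le_left (by norm_num)
  have hresc : (fun ξ : E => (((‖((2 : ℝ) ^ j) • ξ‖ ^ 2 : ℝ)) : ℂ)) =
      Complex.ofRealCLM ∘ fun ξ : E => (2 : ℝ) ^ (2 * j) * ‖ξ‖ ^ 2 := by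
    funext ξ
    simp only [comp_apply, Complex.ofRealCLM_apply, norm_smul, mul_pow, Real.norm_eq_abs, sq_abs,
      two_zpow_two_mul]
  have hB : ∀ N ≤ n, ∀ x ∈ blockAnnulus E,
      ‖iteratedFDeriv ℝ N (fun ξ : E => (((‖((2 : ℝ) ^ j) • ξ‖ ^ 2 : ℝ)) : ℂ)) x‖ ≤
        (2 : ℝ) ^ (2 * j) * K := by
    intro N hN x hx
    have hsm : ContDiff ℝ ∞ (fun ξ : E => (2 : ℝ) ^ (2 * j) * ‖ξ‖ ^ 2) :=
      contDiff_const.mul (contDiff_norm_sq ℝ)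
    rw [hresc, ContinuousLinearMap.iteratedFDeriv_comp_left _ hsm.contDiffAt (mod_cast le_top)]
    refine (ContinuousLinearMap.norm_compContinuousMultilinearMap_le _ _).trans ?_
    have h1 : ‖Complex.ofRealCLM‖ ≤ 1 := Complex.ofRealLI.norm_toContinuousLinearMap_le
    have hsq : ‖iteratedFDeriv ℝ N (fun ξ : E => (2 : ℝ) ^ (2 * j) * ‖ξ‖ ^ 2) x‖ ≤ (2 : ℝ) ^ (2 * j) * K := by
      rw [show (fun ξ : E => (2 : ℝ) ^ (2 * j) * ‖ξ‖ ^ 2) = (2 : ℝ) ^ (2 * j) • fun ξ : E => ‖ξ‖ ^ 2 from rfl,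
        iteratedFDeriv_const_smul_apply ((contDiff_norm_sq ℝ).contDiffAt.of_le le_top), norm_smul,
        Real.norm_of_nonneg (zpow_nonneg zero_le_two _)]
      gcongr
      rcases N with _ | N
      · rw [norm_iteratedFDeriv_zero, Real.norm_of_nonneg (sq_nonneg _)]
        calc ‖x‖ ^ 2 ≤ 4 ^ 2 := pow_le_pow_left₀ (norm_nonneg _) hx.2 2
          _ ≤ K := by rw [hK]; norm_num
      · calc ‖iteratedFDeriv ℝ (N + 1) (fun ξ : E => ‖ξ‖ ^ 2) x‖ ≤ (max (2 * ‖x‖) 2) ^ (N + 1) :=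
              norm_iteratedFDeriv_norm_sq_le x (Nat.succ_pos N)
          _ ≤ 8 ^ (N + 1) := pow_le_pow_left₀ (by positivity) (max_le (by linarith [hx.2]) (by norm_num)) _
          _ ≤ 8 ^ n := pow_le_pow_right₀ (by norm_num) hN
          _ ≤ K := le_max_right _ _
    calc ‖Complex.ofRealCLM‖ * ‖iteratedFDeriv ℝ N (fun ξ : E => (2 : ℝ) ^ (2 * j) * ‖ξ‖ ^ 2) x‖
        ≤ 1 * ((2 : ℝ) ^ (2 * j) * K) := by gcongr
      _ = (2 : ℝ) ^ (2 * j) * K := one_mul _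
  have hmain := hC _ hg j ((2 : ℝ) ^ (2 * j) * K) (by positivity) hB u
  have h2pi : (-(2 * π) ^ 2 : ℂ) ≠ 0 := by simp [Real.pi_ne_zero]
  rw [TemperedDistribution.laplacian_eq_fourierMultiplierCLM]
  have hcast : (-(2 * π) ^ 2 : ℝ) • fourierMultiplierCLM F (fun x : E => ((‖x‖ ^ 2 : ℝ) : ℂ)) (lpBlock j u) =
      (-(2 * π) ^ 2 : ℂ) • fourierMultiplierCLM F (fun x : E => ((‖x‖ ^ 2 : ℝ) : ℂ)) (lpBlock j u) := by
    rw [← Complex.coe_smul]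
    push_cast
    rfl
  rw [hcast, eLpNormDistrib_const_smul h2pi]
  calc ‖(-(2 * π) ^ 2 : ℂ)‖ₑ * eLpNormDistrib p (fourierMultiplierCLM F
        (fun x : E => ((‖x‖ ^ 2 : ℝ) : ℂ)) (lpBlock j u))
      ≤ ‖(-(2 * π) ^ 2 : ℂ)‖ₑ * (C * ENNReal.ofReal ((2 : ℝ) ^ (2 * j) * K) * eLpNormDistrib p (lpBlock j u)) := by
        gcongr
    _ = ((‖(-(2 * π) ^ 2 : ℂ)‖₊ * C * K.toNNReal : ℝ≥0) : ℝ≥0∞) * ENNReal.ofReal ((2 : ℝ) ^ (2 * j)) *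
          eLpNormDistrib p (lpBlock j u) := by
        rw [ENNReal.ofReal_mul (zpow_nonneg zero_le_two _), ENNReal.coe_mul, ENNReal.coe_mul,
          enorm_eq_nnnorm]
        simp only [ENNReal.ofReal, mul_assoc, mul_comm, mul_left_comm]

end DerivativeBernstein

/-! ## BCD Lemma 2.2: symbols smooth off the origin with homogeneous-type bounds -/

section HomogeneousSymbols

variable {E : Type*} [NormedAddCommGroup E] [InnerProductSpace ℝ E]

/-- The **block-truncated symbol** `σ_j(ξ) = σ(ξ) ψ(2^{-j} ξ)`: the symbol `σ` cut off by the
rescaled reproducing symbol `ψ_j = ψ(2^{-j} ·)` of `Δ̇_j` (`ψ_j = 1` on `supp φ_j`). For a symbol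
`σ`
that is smooth only on `E ∖ {0}` (e.g. `|ξ|^m`, the Leray projector, Riesz transforms), `σ_j` is a
genuine smooth compactly supported multiplier and `σ_j(D) Δ̇_j` *is* the operator `σ(D) Δ̇_j` of
BCD Lemma 2.2; for `σ` of temperate growth the truncation is invisible
(`fourierMultiplierCLM_truncSymbol_lpBlock`). [folklore] -/
def truncSymbol (σ : E → ℂ) (j : ℤ) : E → ℂ :=
  σ * fun ξ : E => bernsteinSymbol (((2 : ℝ) ^ (-j)) • ξ)

/-- Unfolding `truncSymbol`. [folklore] -/
theorem truncSymbol_apply (σ : E → ℂ) (j : ℤ) (ξ : E) :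
    truncSymbol σ j ξ = σ ξ * bernsteinSymbol (((2 : ℝ) ^ (-j)) • ξ) := rfl

/-- The rescaled truncated symbol: `σ_j(2^j ξ) = σ(2^j ξ) ψ(ξ)`. [folklore] -/
theorem truncSymbol_two_zpow_smul (σ : E → ℂ) (j : ℤ) (ξ : E) :
    truncSymbol σ j (((2 : ℝ) ^ j) • ξ) = σ (((2 : ℝ) ^ j) • ξ) * bernsteinSymbol ξ := by
  rw [truncSymbol_apply, smul_smul, ← zpow_add₀ (two_ne_zero' ℝ), neg_add_cancel, zpow_zero, one_smul]

/-- `ψ(2^{-j} ·) = 0` on the closed ball of radius `2^j/4`. [folklore] -/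
theorem bernsteinSymbol_rescaled_eq_zero_of_norm_le {j : ℤ} {ξ : E} (h : ‖ξ‖ ≤ (2 : ℝ) ^ j * 4⁻¹) :
    bernsteinSymbol (((2 : ℝ) ^ (-j)) • ξ) = 0 := by
  refine bernsteinSymbol_eq_zero_of_norm_le ?_
  rw [norm_two_zpow_smul]
  calc (2 : ℝ) ^ (-j) * ‖ξ‖ ≤ (2 : ℝ) ^ (-j) * ((2 : ℝ) ^ j * 4⁻¹) :=
        mul_le_mul_of_nonneg_left h (zpow_nonneg zero_le_two _)
    _ = 4⁻¹ := by
        rw [← mul_assoc, ← zpow_add₀ (two_ne_zero' ℝ), neg_add_cancel, zpow_zero, one_mul]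

/-- The support of `ψ(2^{-j} ·)` stays away from the origin: it lies in `{2^j/4 ≤ ‖ξ‖} ⊆ E ∖
{0}`. [folklore] -/
theorem tsupport_bernsteinSymbol_rescaled_subset (j : ℤ) :
    tsupport (fun ξ : E => bernsteinSymbol (((2 : ℝ) ^ (-j)) • ξ)) ⊆ {0}ᶜ := by
  have hr : 0 < (2 : ℝ) ^ j * 4⁻¹ := by positivity
  refine (closure_minimal (t := {ξ : E | (2 : ℝ) ^ j * 4⁻¹ ≤ ‖ξ‖}) (fun ξ hξ => ?_)
    (isClosed_le continuous_const continuous_norm)).trans fun ξ hξ h0 => ?_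
  · rw [Function.mem_support] at hξ
    by_contra h
    exact hξ (bernsteinSymbol_rescaled_eq_zero_of_norm_le (not_le.1 h).le)
  · rw [Set.mem_singleton_iff] at h0
    rw [h0, Set.mem_setOf_eq, norm_zero] at hξ
    exact absurd hξ (not_le.2 hr)

/-- `σ_j` is smooth on all of `E` as soon as `σ` is smooth on `E ∖ {0}`. [folklore] -/
theorem contDiff_truncSymbol {σ : E → ℂ} (hσ : ContDiffOn ℝ ∞ σ {0}ᶜ) (j : ℤ) :
    ContDiff ℝ ∞ (truncSymbol σ j) :=
  contDiff_mul_of_tsupport_subset isOpen_compl_singleton hσ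
    (contDiff_bernsteinSymbol.comp (contDiff_const_smul _)) (tsupport_bernsteinSymbol_rescaled_subset j)

variable [FiniteDimensional ℝ E]

/-- `σ_j` has compact support (that of `ψ(2^{-j} ·)`). [folklore] -/
theorem hasCompactSupport_truncSymbol (σ : E → ℂ) (j : ℤ) : HasCompactSupport (truncSymbol σ j) :=
  (hasCompactSupport_bernsteinSymbol.comp_smul (zpow_ne_zero (-j) (two_ne_zero' ℝ))).mul_left

/-- `σ_j` has temperate growth (smooth with compact support), so `σ_j(D)` is an honest Fourier
multiplier on `𝓢'`. [folklore] -/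
theorem hasTemperateGrowth_truncSymbol {σ : E → ℂ} (hσ : ContDiffOn ℝ ∞ σ {0}ᶜ) (j : ℤ) :
    (truncSymbol σ j).HasTemperateGrowth :=
  (hasCompactSupport_truncSymbol σ j).hasTemperateGrowth (contDiff_truncSymbol hσ j)

omit [InnerProductSpace ℝ E] [FiniteDimensional ℝ E] in
/-- On the annulus `1/4 ≤ ‖x‖ ≤ 4`, `‖x‖^t ≤ 4^{|t|}` for every real `t`. [folklore] -/
theorem norm_rpow_le_of_mem_blockAnnulus {x : E} (hx : x ∈ blockAnnulus E) (t : ℝ) :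
    ‖x‖ ^ t ≤ (4 : ℝ) ^ |t| := by
  have hx0 : 0 < ‖x‖ := lt_of_lt_of_le (by norm_num) hx.1
  rcases le_or_gt 0 t with ht | ht
  · rw [abs_of_nonneg ht]
    exact Real.rpow_le_rpow (norm_nonneg _) hx.2 ht
  · rw [abs_of_neg ht, ← inv_inv ‖x‖, Real.inv_rpow (inv_nonneg.2 (norm_nonneg _)), ← Real.rpow_neg
      (inv_nonneg.2 (norm_nonneg _))]
    refine Real.rpow_le_rpow (inv_nonneg.2 (norm_nonneg _)) ?_ (neg_nonneg.2 ht.le)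
    rw [inv_le_comm₀ hx0 (by norm_num)]
    exact hx.1

/-- `(2^j)ⁱ (2^j)^{m-i} = 2^{jm}` (`i ∈ ℕ`, `m ∈ ℝ`, `j ∈ ℤ`). [folklore] -/
theorem two_zpow_pow_mul_rpow (j : ℤ) (i : ℕ) (m : ℝ) :
    ((2 : ℝ) ^ j) ^ i * ((2 : ℝ) ^ j) ^ (m - i) = (2 : ℝ) ^ ((j : ℝ) * m) := by
  have hc : 0 < (2 : ℝ) ^ j := zpow_pos two_pos _
  rw [← Real.rpow_natCast, ← Real.rpow_add hc, add_sub_cancel, ← Real.rpow_intCast,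
    ← Real.rpow_mul zero_le_two]

/-- **Derivatives of the rescaled truncated symbols, uniformly in `j`.** If `σ ∈ C^∞(E ∖ {0})`
satisfies the homogeneous-type bounds `‖D^N σ(ξ)‖ ≤ C_N ‖ξ‖^{m-N}` (`ξ ≠ 0`), then for every `n`
there is `K` with `‖D^N [σ_j(2^j ·)](x)‖ ≤ K 2^{jm}` for all `j ∈ ℤ`, `N ≤ n`, `x` in the annulus
`1/4 ≤ ‖x‖ ≤ 4` — `σ_j(2^j x) = σ(2^j x) ψ(x)`, Leibniz on the open set `E ∖ {0}`, the chain rule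
for
the dilation and `‖x‖^{m-i} ≤ 4^{|m|+n}` on the annulus (BCD, proof of Lemma 2.2).
[cite: BahouriCheminDanchin2011, Lemma 2.2] -/
theorem exists_norm_iteratedFDeriv_truncSymbol_rescaled_le {σ : E → ℂ} (hσ : ContDiffOn ℝ ∞ σ {0}ᶜ)
    {m : ℝ} {Cσ : ℕ → ℝ} (hCσ : ∀ (N : ℕ) (ξ : E), ξ ≠ 0 → ‖iteratedFDeriv ℝ N σ ξ‖ ≤ Cσ N * ‖ξ‖ ^ (m - N))
    (n : ℕ) :
    ∃ K : ℝ, 0 ≤ K ∧ ∀ (j : ℤ), ∀ N ≤ n, ∀ x ∈ blockAnnulus E,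
      ‖iteratedFDeriv ℝ N (fun ξ : E => truncSymbol σ j (((2 : ℝ) ^ j) • ξ)) x‖ ≤
        K * (2 : ℝ) ^ ((j : ℝ) * m) := by
  set S : Set E := {0}ᶜ with hSdef
  have hS : IsOpen S := isOpen_compl_singleton
  have hSu : UniqueDiffOn ℝ S := hS.uniqueDiffOn
  set Csum : ℝ := ∑ i ∈ Finset.range (n + 1), |Cσ i| with hCsum
  have hCsum0 : 0 ≤ Csum := Finset.sum_nonneg fun i _ => abs_nonneg _
  set A : ℝ := (4 : ℝ) ^ (|m| + n) with hA
  have hA0 : 0 ≤ A := by positivity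
  set P : ℝ := (Finset.Iic ((0 : ℕ), n)).sup (schwartzSeminormFamily ℂ E ℂ) (bernsteinSchwartz E) with hP
  have hP0 : 0 ≤ P := apply_nonneg _ _
  refine ⟨2 ^ n * Csum * A * P, by positivity, fun j N hN x hx => ?_⟩
  have hx0 : x ≠ 0 := fun h => by
    have := hx.1; rw [h, norm_zero] at this; norm_num at this
  have hxS : x ∈ S := hx0
  set c : ℝ := (2 : ℝ) ^ j with hc
  have hc0 : 0 < c := zpow_pos two_pos _
  set g : E →L[ℝ] E := c • ContinuousLinearMap.id ℝ E with hg
  have hgx : ∀ y : E, g y = c • y := fun y => rfl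
  have hpre : ⇑g ⁻¹' S = S := by
    ext y
    simp only [Set.mem_preimage, hSdef, Set.mem_compl_iff, Set.mem_singleton_iff, hgx,
      smul_eq_zero, hc0.ne', false_or]
  have hgnorm : ‖g‖ ≤ c := by
    rw [hg, norm_smul, Real.norm_of_nonneg hc0.le]
    exact (mul_le_mul_of_nonneg_left ContinuousLinearMap.norm_id_le hc0.le).trans (mul_one c).le
  -- the function as a product of a within-smooth and a smooth factor
  have hfun : (fun ξ : E => truncSymbol σ j (((2 : ℝ) ^ j) • ξ)) = fun ξ => (σ ∘ ⇑g) ξ * bernsteinSymbol ξ := by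
    funext ξ
    rw [truncSymbol_two_zpow_smul]
    rfl
  have hσg : ContDiffOn ℝ ∞ (σ ∘ ⇑g) S := by
    rw [← hpre]
    exact hσ.comp g.contDiff.contDiffOn (fun y hy => hy)
  have hψS : ContDiffOn ℝ ∞ (bernsteinSymbol : E → ℂ) S := contDiff_bernsteinSymbol.contDiffOn
  rw [hfun, ← iteratedFDerivWithin_of_isOpen N hS hxS]
  have hleib := norm_iteratedFDerivWithin_mul_le hσg hψS hSu hxS (n := N) (mod_cast le_top)
  refine hleib.trans ?_
  -- bound each term
  have hterm : ∀ i ∈ Finset.range (N + 1),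
      (N.choose i : ℝ) * ‖iteratedFDerivWithin ℝ i (σ ∘ ⇑g) S x‖ *
        ‖iteratedFDerivWithin ℝ (N - i) (bernsteinSymbol : E → ℂ) S x‖ ≤
      (N.choose i : ℝ) * (Csum * A * P * (2 : ℝ) ^ ((j : ℝ) * m)) := by
    intro i hi
    have hiN : i ≤ N := Nat.lt_succ_iff.mp (Finset.mem_range.mp hi)
    have hin : i ≤ n := hiN.trans hN
    -- the `σ` factor
    have h1 : ‖iteratedFDerivWithin ℝ i (σ ∘ ⇑g) S x‖ ≤ |Cσ i| * A * (2 : ℝ) ^ ((j : ℝ) * m) := by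
      have hcomp := ContinuousLinearMap.iteratedFDerivWithin_comp_right g hσ hSu (by rwa [hpre])
        (x := x) (by rw [← Set.mem_preimage, hpre]; exact hxS) (i := i) (mod_cast le_top)
      rw [hpre] at hcomp
      rw [hcomp]
      refine (ContinuousMultilinearMap.norm_compContinuousLinearMap_le _ _).trans ?_
      rw [Finset.prod_const, Finset.card_univ, Fintype.card_fin,
        iteratedFDerivWithin_of_isOpen i hS (show g x ∈ S by rw [← Set.mem_preimage, hpre]; exact hxS)]
      have hgx0 : g x ≠ 0 := by rw [hgx]; exact smul_ne_zero hc0.ne' hx0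
      have hb := hCσ i (g x) hgx0
      rw [hgx, norm_smul, Real.norm_of_nonneg hc0.le] at hb
      have hxmi : ‖x‖ ^ (m - i) ≤ A := by
        refine (norm_rpow_le_of_mem_blockAnnulus hx _).trans ?_
        rw [hA]
        refine Real.rpow_le_rpow_of_exponent_le (by norm_num) ?_
        calc |m - (i : ℝ)| ≤ |m| + |(i : ℝ)| := abs_sub m i
          _ = |m| + i := by rw [Nat.abs_cast]
          _ ≤ |m| + n := by gcongr
      calc ‖iteratedFDeriv ℝ i σ (g x)‖ * ‖g‖ ^ i
          ≤ (Cσ i * (c * ‖x‖) ^ (m - i)) * c ^ i := by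
            gcongr
            · exact le_trans (by positivity) hb
            · rw [hgx]; exact hb
          _ = Cσ i * (c ^ i * c ^ (m - i)) * ‖x‖ ^ (m - i) := by
            rw [Real.mul_rpow hc0.le (norm_nonneg _)]; ring
          _ = Cσ i * (2 : ℝ) ^ ((j : ℝ) * m) * ‖x‖ ^ (m - i) := by rw [hc, two_zpow_pow_mul_rpow]
          _ ≤ |Cσ i| * (2 : ℝ) ^ ((j : ℝ) * m) * A := by
            gcongr
            exact le_abs_self _
          _ = |Cσ i| * A * (2 : ℝ) ^ ((j : ℝ) * m) := by ring
    -- the `ψ` factor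
    have h2 : ‖iteratedFDerivWithin ℝ (N - i) (bernsteinSymbol : E → ℂ) S x‖ ≤ P := by
      rw [iteratedFDerivWithin_of_isOpen (N - i) hS hxS, ← coe_bernsteinSchwartz]
      have := le_seminorm ℂ 0 (N - i) (bernsteinSchwartz E) x
      rw [pow_zero, one_mul] at this
      refine this.trans (Seminorm.le_def.1 (Finset.le_sup (f := schwartzSeminormFamily ℂ E ℂ)
        (Finset.mem_Iic.2 (Prod.mk_le_mk.2 ⟨le_rfl, (Nat.sub_le N i).trans hN⟩))) _)
    have h3 : |Cσ i| ≤ Csum := by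
      rw [hCsum]
      exact Finset.single_le_sum (f := fun i => |Cσ i|) (fun _ _ => abs_nonneg _)
        (Finset.mem_range.2 (Nat.lt_succ_of_le hin))
    have h2m : 0 ≤ (2 : ℝ) ^ ((j : ℝ) * m) := Real.rpow_nonneg zero_le_two _
    calc (N.choose i : ℝ) * ‖iteratedFDerivWithin ℝ i (σ ∘ ⇑g) S x‖ *
          ‖iteratedFDerivWithin ℝ (N - i) (bernsteinSymbol : E → ℂ) S x‖
        ≤ (N.choose i : ℝ) * (|Cσ i| * A * (2 : ℝ) ^ ((j : ℝ) * m)) * P := by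
          gcongr
      _ ≤ (N.choose i : ℝ) * (Csum * A * (2 : ℝ) ^ ((j : ℝ) * m)) * P := by gcongr
      _ = (N.choose i : ℝ) * (Csum * A * P * (2 : ℝ) ^ ((j : ℝ) * m)) := by ring
  refine (Finset.sum_le_sum hterm).trans ?_
  rw [← Finset.sum_mul, ← Nat.cast_sum, Nat.sum_range_choose]
  push_cast
  have h2N : (2 : ℝ) ^ N ≤ 2 ^ n := pow_le_pow_right₀ one_le_two hN
  have h2m : 0 ≤ (2 : ℝ) ^ ((j : ℝ) * m) := Real.rpow_nonneg zero_le_two _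
  calc (2 : ℝ) ^ N * (Csum * A * P * (2 : ℝ) ^ ((j : ℝ) * m))
      ≤ 2 ^ n * (Csum * A * P * (2 : ℝ) ^ ((j : ℝ) * m)) := by gcongr
    _ = 2 ^ n * Csum * A * P * (2 : ℝ) ^ ((j : ℝ) * m) := by ring

variable [MeasurableSpace E] [BorelSpace E] {F : Type*} [NormedAddCommGroup F] [NormedSpace ℂ F]

omit [FiniteDimensional ℝ E] [MeasurableSpace E] [BorelSpace E] in
/-- `φ_j ψ_j = φ_j`: the rescaled reproducing symbol is `1` wherever the `j`-th dyadic symbol is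
nonzero. [folklore] -/
theorem dyadicSymbol_mul_bernsteinSymbol_rescaled (j : ℤ) :
    (dyadicSymbol j : E → ℂ) * (fun ξ : E => bernsteinSymbol (((2 : ℝ) ^ (-j)) • ξ)) = dyadicSymbol j := by
  funext ξ
  have h := congr_fun (dyadicSymbol_zero_mul_bernsteinSymbol (E := E)) (((2 : ℝ) ^ (-j)) • ξ)
  simp only [Pi.mul_apply] at h ⊢
  rwa [dyadicSymbol_two_zpow_smul, zero_sub, neg_neg] at h

/-- `Δ̇_j = ψ_j(D) Δ̇_j` on `𝓢'(E, F)` (`ψ_j = ψ(2^{-j} ·)`). [folklore] -/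
theorem lpBlock_eq_fourierMultiplierCLM_bernsteinSymbol_rescaled (j : ℤ) (u : 𝓢'(E, F)) :
    lpBlock j u = fourierMultiplierCLM F (fun ξ : E => bernsteinSymbol (((2 : ℝ) ^ (-j)) • ξ)) (lpBlock j u) := by
  have hψ : (fun ξ : E => bernsteinSymbol (((2 : ℝ) ^ (-j)) • ξ)).HasTemperateGrowth :=
    hasTemperateGrowth_bernsteinSymbol.comp (((2 : ℝ) ^ (-j)) • ContinuousLinearMap.id ℝ E).hasTemperateGrowth
  rw [lpBlock_apply, TemperedDistribution.fourierMultiplierCLM_fourierMultiplierCLM_apply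
    (hasTemperateGrowth_dyadicSymbol j) hψ, dyadicSymbol_mul_bernsteinSymbol_rescaled]

/-- For a symbol `σ` of temperate growth the truncation is invisible on the block:
`σ_j(D) Δ̇_j = σ(D) Δ̇_j`. [folklore] -/
theorem fourierMultiplierCLM_truncSymbol_lpBlock {σ : E → ℂ} (hσ : σ.HasTemperateGrowth) (j : ℤ)
    (u : 𝓢'(E, F)) :
    fourierMultiplierCLM F (truncSymbol σ j) (lpBlock j u) = fourierMultiplierCLM F σ (lpBlock j u) := by
  have hψ : (fun ξ : E => bernsteinSymbol (((2 : ℝ) ^ (-j)) • ξ)).HasTemperateGrowth :=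
    hasTemperateGrowth_bernsteinSymbol.comp (((2 : ℝ) ^ (-j)) • ContinuousLinearMap.id ℝ E).hasTemperateGrowth
  conv_rhs => rw [lpBlock_eq_fourierMultiplierCLM_bernsteinSymbol_rescaled j u,
    TemperedDistribution.fourierMultiplierCLM_fourierMultiplierCLM_apply hψ hσ]
  rw [truncSymbol, mul_comm]

variable [CompleteSpace F]

/-- **BCD Lemma 2.2 (Fourier multipliers of homogeneous type on the dyadic blocks).** Let
`σ ∈ C^∞(E ∖ {0})` satisfy `‖D^N σ(ξ)‖ ≤ C_N ‖ξ‖^{m-N}` for all `N` and `ξ ≠ 0` (e.g. `σ` smooth and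
positively homogeneous of degree `m` off the origin). Then for `1 ≤ p ≤ ∞` there is `C` with
`‖σ_j(D) Δ̇_j u‖_{L^p} ≤ C 2^{jm} ‖Δ̇_j u‖_{L^p}` for all `j ∈ ℤ`, `u ∈ 𝓢'(E, F)`, where
`σ_j = σ ψ(2^{-j} ·)` is the block truncation (`truncSymbol`; `= σ(D) Δ̇_j` when `σ` is temperate,
`fourierMultiplierCLM_truncSymbol_lpBlock`). BCD state this for functions with `supp û ⊂ λ𝒞` and
`k = 2[1 + d/2]` derivatives; here all derivatives are assumed (as holds for smooth symbols) and the
spectral localisation is `Δ̇_j`. [cite: BahouriCheminDanchin2011, Lemma 2.2] -/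
theorem exists_eLpNormDistrib_truncSymbol_lpBlock_le (p : ℝ≥0∞) [Fact (1 ≤ p)] {σ : E → ℂ}
    (hσ : ContDiffOn ℝ ∞ σ {0}ᶜ) {m : ℝ} {Cσ : ℕ → ℝ}
    (hCσ : ∀ (N : ℕ) (ξ : E), ξ ≠ 0 → ‖iteratedFDeriv ℝ N σ ξ‖ ≤ Cσ N * ‖ξ‖ ^ (m - N)) :
    ∃ C : ℝ≥0, ∀ (j : ℤ) (u : 𝓢'(E, F)),
      eLpNormDistrib p (fourierMultiplierCLM F (truncSymbol σ j) (lpBlock j u)) ≤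
        C * (2 : ℝ≥0∞) ^ ((j : ℝ) * m) * eLpNormDistrib p (lpBlock j u) := by
  obtain ⟨n, C, hC⟩ := exists_eLpNormDistrib_fourierMultiplierCLM_lpBlock_le (E := E) (F := F) p
  obtain ⟨K, hK0, hK⟩ := exists_norm_iteratedFDeriv_truncSymbol_rescaled_le hσ hCσ n
  refine ⟨C * K.toNNReal, fun j u => ?_⟩
  have h2m : 0 ≤ (2 : ℝ) ^ ((j : ℝ) * m) := Real.rpow_nonneg zero_le_two _
  have hmain := hC (truncSymbol σ j) (hasTemperateGrowth_truncSymbol hσ j) j (K * (2 : ℝ) ^ ((j : ℝ) * m))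
    (by positivity) (hK j) u
  calc eLpNormDistrib p (fourierMultiplierCLM F (truncSymbol σ j) (lpBlock j u))
      ≤ C * ENNReal.ofReal (K * (2 : ℝ) ^ ((j : ℝ) * m)) * eLpNormDistrib p (lpBlock j u) := hmain
    _ = ((C * K.toNNReal : ℝ≥0) : ℝ≥0∞) * (2 : ℝ≥0∞) ^ ((j : ℝ) * m) * eLpNormDistrib p (lpBlock j u) := by
        rw [ENNReal.ofReal_mul hK0, ← ENNReal.ofReal_ofNat 2, ENNReal.ofReal_rpow_of_pos two_pos,
          ENNReal.coe_mul]
        simp only [ENNReal.ofReal, mul_assoc]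

end HomogeneousSymbols

/-! ## Consequences for the Besov norms: `∂_m : Ḃ^s_{p,q} → Ḃ^{s-1}_{p,q}`, `Δ : Ḃ^s_{p,q} →
Ḃ^{s-2}_{p,q}` -/

section BesovDerivatives

open scoped LineDeriv Laplacian

variable {E : Type*} [NormedAddCommGroup E] [InnerProductSpace ℝ E] [FiniteDimensional ℝ E]
  [MeasurableSpace E] [BorelSpace E] {F : Type*} [NormedAddCommGroup F] [NormedSpace ℂ F]

/-- `ENNReal.ofReal (2^j) = 2^{(j : ℝ)}` in `ℝ≥0∞` (integer `j`). [folklore] -/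
theorem ofReal_two_zpow (j : ℤ) : ENNReal.ofReal ((2 : ℝ) ^ j) = (2 : ℝ≥0∞) ^ ((j : ℝ)) := by
  rw [← Real.rpow_intCast, ← ENNReal.ofReal_rpow_of_pos two_pos, ENNReal.ofReal_ofNat]

/-- The low-frequency cut-offs commute with `∂_m`: `Ṡ_j ∂_m = ∂_m Ṡ_j` on `𝓢'(E, F)`. [folklore] -/
theorem lowFreqCutoff_lineDeriv_comm (m : E) (j : ℤ) (u : 𝓢'(E, F)) :
    lowFreqCutoff j (∂_{m} u) = ∂_{m} (lowFreqCutoff j u) := by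
  have hg : (fun x : E => ((inner ℝ x m : ℝ) : ℂ)).HasTemperateGrowth := by fun_prop
  rw [TemperedDistribution.lineDeriv_eq_fourierMultiplierCLM,
    TemperedDistribution.lineDeriv_eq_fourierMultiplierCLM, map_smul, lowFreqCutoff_apply,
    lowFreqCutoff_apply,
    TemperedDistribution.fourierMultiplierCLM_fourierMultiplierCLM_apply hg
      (hasTemperateGrowth_lowFreqSymbol j),
    TemperedDistribution.fourierMultiplierCLM_fourierMultiplierCLM_apply
      (hasTemperateGrowth_lowFreqSymbol j) hg, mul_comm (lowFreqSymbol (E := E) j)]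

/-- The low-frequency cut-offs commute with `Δ`: `Ṡ_j Δ = Δ Ṡ_j` on `𝓢'(E, F)`. [folklore] -/
theorem lowFreqCutoff_laplacian_comm (j : ℤ) (u : 𝓢'(E, F)) :
    lowFreqCutoff j (Δ u) = Δ (lowFreqCutoff j u) := by
  have hg : (fun x : E => ((‖x‖ ^ 2 : ℝ) : ℂ)).HasTemperateGrowth := by fun_prop
  rw [TemperedDistribution.laplacian_eq_fourierMultiplierCLM,
    TemperedDistribution.laplacian_eq_fourierMultiplierCLM, ContinuousLinearMap.map_smul_of_tower,
    lowFreqCutoff_apply, lowFreqCutoff_apply,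
    TemperedDistribution.fourierMultiplierCLM_fourierMultiplierCLM_apply hg
      (hasTemperateGrowth_lowFreqSymbol j),
    TemperedDistribution.fourierMultiplierCLM_fourierMultiplierCLM_apply
      (hasTemperateGrowth_lowFreqSymbol j) hg, mul_comm (lowFreqSymbol (E := E) j)]

/-- `∂_m` is continuous on `𝓢'(E, F)` (it is the continuous linear map `2πi ⟪D, m⟫`). [folklore] -/
theorem continuous_lineDeriv_distribution (m : E) : Continuous fun u : 𝓢'(E, F) => ∂_{m} u := by
  have h : (fun u : 𝓢'(E, F) => ∂_{m} u) =
      ⇑((2 * π * Complex.I) •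
        TemperedDistribution.fourierMultiplierCLM F (fun x : E => ((inner ℝ x m : ℝ) : ℂ))) := by
    funext u
    rw [TemperedDistribution.lineDeriv_eq_fourierMultiplierCLM]
    rfl
  rw [h]
  exact ContinuousLinearMap.continuous _

/-- `Δ` is continuous on `𝓢'(E, F)` (it is the continuous linear map `-(2π)² |D|²`). [folklore] -/
theorem continuous_laplacian_distribution : Continuous fun u : 𝓢'(E, F) => Δ u := by
  have h : (fun u : 𝓢'(E, F) => Δ u) =
      ⇑((-(2 * π) ^ 2 : ℝ) •
        TemperedDistribution.fourierMultiplierCLM F (fun x : E => ((‖x‖ ^ 2 : ℝ) : ℂ))) := by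
    funext u
    rw [TemperedDistribution.laplacian_eq_fourierMultiplierCLM]
    rfl
  rw [h]
  exact ContinuousLinearMap.continuous _

variable [CompleteSpace F]

/-- **The directional derivative maps `Ḃ^s_{p,q}` to `Ḃ^{s-1}_{p,q}`** (Danchin 2018, §2.2: "the
gradient operator maps `Ḃ^s_{p,r}` in `Ḃ^{s-1}_{p,r}`"; BCD Prop. 2.? via Lemma 2.1): for `1 ≤ p
≤ ∞`
there is `C` with `‖∂_m u‖_{Ḃ^{s-1}_{p,q}} ≤ C ‖m‖ ‖u‖_{Ḃ^s_{p,q}}` for all `m ∈ E`, `s ∈ ℝ`, `q`,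
`u ∈ 𝓢'(E, F)` (Bernstein with one derivative on each block).
[cite: Danchin2018FourierCNS, Prop. 2.1] -/
theorem exists_eHomBesovNorm_lineDeriv_le (p : ℝ≥0∞) [Fact (1 ≤ p)] :
    ∃ C : ℝ≥0, ∀ (m : E) (s : ℝ) (q : ℝ≥0∞) (u : 𝓢'(E, F)),
      eHomBesovNorm (s - 1) p q (∂_{m} u) ≤ C * ENNReal.ofReal ‖m‖ * eHomBesovNorm s p q u := by
  obtain ⟨C, hC⟩ := exists_eLpNormDistrib_lineDeriv_lpBlock_le (E := E) (F := F) p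
  refine ⟨C, fun m s q u => ?_⟩
  have hcoe : ((C * ‖m‖₊ : ℝ≥0) : ℝ≥0∞) = C * ENNReal.ofReal ‖m‖ := by
    rw [ENNReal.coe_mul, ofReal_norm]
    rfl
  have hfac : ∀ j : ℤ, lpBlockWeight (s - 1) p (∂_{m} u) j ≤
      ((C * ‖m‖₊ : ℝ≥0) : ℝ≥0∞) * lpBlockWeight s p u j := by
    intro j
    rw [hcoe]
    simp only [lpBlockWeight]
    rw [lpBlock_lineDeriv_comm]
    calc (2 : ℝ≥0∞) ^ ((j : ℝ) * (s - 1)) * eLpNormDistrib p (∂_{m} (lpBlock j u))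
        ≤ (2 : ℝ≥0∞) ^ ((j : ℝ) * (s - 1)) * (C * ENNReal.ofReal ((2 : ℝ) ^ j * ‖m‖) *
            eLpNormDistrib p (lpBlock j u)) := by
          gcongr
          exact hC m j u
      _ = C * ENNReal.ofReal ‖m‖ * ((2 : ℝ≥0∞) ^ ((j : ℝ) * (s - 1)) * (2 : ℝ≥0∞) ^ ((j : ℝ)) *
            eLpNormDistrib p (lpBlock j u)) := by
          rw [ENNReal.ofReal_mul (zpow_nonneg zero_le_two _), ofReal_two_zpow]
          ring
      _ = C * ENNReal.ofReal ‖m‖ * ((2 : ℝ≥0∞) ^ ((j : ℝ) * s) * eLpNormDistrib p (lpBlock j u)) := by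
          rw [two_rpow_mul_two_rpow, show (j : ℝ) * (s - 1) + (j : ℝ) = (j : ℝ) * s by ring]
  unfold eHomBesovNorm
  rw [← hcoe]
  refine eLpNorm_le_mul_eLpNorm_of_ae_le_mul' (ae_of_all _ fun j => ?_) q
  simpa only [enorm_eq_self] using hfac j

/-- **The Laplacian maps `Ḃ^s_{p,q}` to `Ḃ^{s-2}_{p,q}`**: for `1 ≤ p ≤ ∞` there is `C` with
`‖Δ u‖_{Ḃ^{s-2}_{p,q}} ≤ C ‖u‖_{Ḃ^s_{p,q}}` for all `s ∈ ℝ`, `q`, `u ∈ 𝓢'(E, F)` (Bernstein with two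
derivatives on each block). [cite: Danchin2018FourierCNS, Prop. 2.1] -/
theorem exists_eHomBesovNorm_laplacian_le (p : ℝ≥0∞) [Fact (1 ≤ p)] :
    ∃ C : ℝ≥0, ∀ (s : ℝ) (q : ℝ≥0∞) (u : 𝓢'(E, F)),
      eHomBesovNorm (s - 2) p q (Δ u) ≤ C * eHomBesovNorm s p q u := by
  obtain ⟨C, hC⟩ := exists_eLpNormDistrib_laplacian_lpBlock_le (E := E) (F := F) p
  refine ⟨C, fun s q u => ?_⟩
  have hfac : ∀ j : ℤ, lpBlockWeight (s - 2) p (Δ u) j ≤ (C : ℝ≥0∞) * lpBlockWeight s p u j := by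
    intro j
    simp only [lpBlockWeight]
    rw [lpBlock_laplacian_comm]
    calc (2 : ℝ≥0∞) ^ ((j : ℝ) * (s - 2)) * eLpNormDistrib p (Δ (lpBlock j u))
        ≤ (2 : ℝ≥0∞) ^ ((j : ℝ) * (s - 2)) * (C * ENNReal.ofReal ((2 : ℝ) ^ (2 * j)) *
            eLpNormDistrib p (lpBlock j u)) := by
          gcongr
          exact hC j u
      _ = C * ((2 : ℝ≥0∞) ^ ((j : ℝ) * (s - 2)) * (2 : ℝ≥0∞) ^ (((2 * j : ℤ) : ℝ)) *
            eLpNormDistrib p (lpBlock j u)) := by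
          rw [ofReal_two_zpow]
          ring
      _ = C * ((2 : ℝ≥0∞) ^ ((j : ℝ) * s) * eLpNormDistrib p (lpBlock j u)) := by
          rw [two_rpow_mul_two_rpow]
          push_cast
          rw [show (j : ℝ) * (s - 2) + 2 * (j : ℝ) = (j : ℝ) * s by ring]
  unfold eHomBesovNorm
  refine eLpNorm_le_mul_eLpNorm_of_ae_le_mul' (ae_of_all _ fun j => ?_) q
  simpa only [enorm_eq_self] using hfac j

/-- **`∂_m` maps the class `Ḃ^s_{p,q}` to `Ḃ^{s-1}_{p,q}`** (finite norm by
`exists_eHomBesovNorm_lineDeriv_le`; the realisation condition is preserved because `Ṡ_j` commutes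
with the continuous linear map `∂_m`). [cite: Danchin2018FourierCNS, Prop. 2.1] -/
theorem MemHomBesov.lineDeriv {s : ℝ} {p q : ℝ≥0∞} [Fact (1 ≤ p)] {u : 𝓢'(E, F)}
    (h : MemHomBesov s p q u) (m : E) : MemHomBesov (s - 1) p q (∂_{m} u) := by
  obtain ⟨C, hC⟩ := exists_eHomBesovNorm_lineDeriv_le (E := E) (F := F) p
  refine ⟨(hC m s q u).trans_lt (ENNReal.mul_lt_top (ENNReal.mul_lt_top ENNReal.coe_lt_top
    ENNReal.ofReal_lt_top) h.1), ?_⟩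
  simp_rw [lowFreqCutoff_lineDeriv_comm]
  have h3 := ((continuous_lineDeriv_distribution (F := F) m).tendsto 0).comp h.2
  have h0 : ∂_{m} (0 : 𝓢'(E, F)) = 0 := by
    rw [TemperedDistribution.lineDeriv_eq_fourierMultiplierCLM, map_zero, smul_zero]
  rw [h0] at h3
  exact h3

/-- **`Δ` maps the class `Ḃ^s_{p,q}` to `Ḃ^{s-2}_{p,q}`.**
[cite: Danchin2018FourierCNS, Prop. 2.1] -/
theorem MemHomBesov.laplacian {s : ℝ} {p q : ℝ≥0∞} [Fact (1 ≤ p)] {u : 𝓢'(E, F)}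
    (h : MemHomBesov s p q u) : MemHomBesov (s - 2) p q (Δ u) := by
  obtain ⟨C, hC⟩ := exists_eHomBesovNorm_laplacian_le (E := E) (F := F) p
  refine ⟨(hC s q u).trans_lt (ENNReal.mul_lt_top ENNReal.coe_lt_top h.1), ?_⟩
  simp_rw [lowFreqCutoff_laplacian_comm]
  have h3 := ((continuous_laplacian_distribution (E := E) (F := F)).tendsto 0).comp h.2
  have h0 : Δ (0 : 𝓢'(E, F)) = 0 := by
    rw [TemperedDistribution.laplacian_eq_fourierMultiplierCLM, map_zero, smul_zero]
  rw [h0] at h3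
  exact h3

end BesovDerivatives

end Literature.Analysis.FunctionSpaces
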